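import Summits.QuantumFields.YangMills.Theorems.UnitScaleTiltProp7TorusGreenGradientBricks
import HarnessLib

/-!
# Route `UnitScaleTilt`, crux K1 «MinimiserStabilityRegPr» (stmt-QuantumFields-19200), route-R E′ path (α′), residue (hK), sub-row (N): DECAY OF THE GRADIENT OF THE TORUS GREEN
# FUNCTION IN `d = 3`, UNIFORM IN THE PERIOD — `|G̃_L(z+eᵢ) − G̃_L(z)|·Σ_μ z̃_μ² ≤ C` for `z ≠ 0` in `(ℤ/Lℤ)³` (`G̃_L = torusGreen`, the zero-mode-removed Green function; `z̃ = valMinAbs`):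
# the lattice, finite-volume form of `∇|x|⁻¹ = O(|x|⁻²)`, i.e. the Newtonian gradient row that (N) feeds to ✓ `…NearFieldShellSum` (`Σ_{r≤ℓ}r²·r⁻² ≍ ℓ`)

Cell `ym3-torus`, D-0154 (3c) twin-width seat `ym-routeR-w3` (gen 5); ★p1 g14 17:33:03Z∕17:53:40Z «hInterp part (B)», standing PASS-at-dry-run 18:44:59Z; LOCATE 19200 evidence #53 §7.  The `d = 3`,
first-difference sibling of ✓ `Literature.Probability.LatticeModels.TorusGreenHessianDecay.torusGreen_hessian_mul_dist_pow_four_le` (d = 4 Hessian), by the same heat-kernel route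
(✓ `torusGreen_eq_integral_add_tail`, ✓ `TorusHeatKernel1D` bounds) and the `d = 3` bricks ✓ `…TorusGreenGradientBricks`.  THEOREMS ONLY (0 `def`, 0 `sorry`); `--supports
stmt-QuantumFields-19200`, count-neutral.  YM₃ on T³ is a ladder rung (R3), not the Clay problem; nothing here claims the stub, the crux, d = 4 or the gap.

WHAT IS PROVED (ns `…Theorems.Prop7TorusGreenGradientDecay`).
* §1 `torusGreen_grad_eq` (any `d`) — `G̃(z+eᵢ) − G̃(z) = ∫₀^S (∏_μq^L_s((z+eᵢ)_μ) − ∏_μq^L_s(z_μ)) ds + L^{−d}Σ_{k≠0}(e^{−Sε_k}∕ε_k)·Re[χ_k(z)(χ_k(eᵢ) − 1)]`.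
* §2 `norm_single_sub_one_div_dispersion_le` (`‖χ_k(eᵢ) − 1‖ ≤ (πL∕4)·ε_k` for `k ≠ 0`: one character factor only cancels `√ε`, the rest is the spectral gap `ε ≥ 8∕L²`),
  ★ `abs_torusGreen_grad_tail_le` — at `S = L²` the Fourier tail is `≤ (π∕4)·C₀^d·L^{1−d}`, `C₀ = Σ_{n∈ℤ}2^{−|n|}`.
* §3 ★★★ `torusGreen_grad_mul_dist_sq_le` (`d = 3`) — `∃ C, ∀ L ≥ 1, ∀ i, ∀ z ≠ 0: |G̃_L(z+eᵢ) − G̃_L(z)|·Σ_μ z̃_μ² ≤ C` (`C = 3K + 3π C₀³∕32`-shaped, absolute).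
HONEST SCOPE.  A Literature-grade lattice lemma placed in the Summits lineage that needs it (the (A) assembly of (hK)); no Yang–Mills statement is touched.  With ✓p658571
(`|∇h| ≲ M∕ℓ` for harmonic `h`) redundant here — this is the pointwise row directly; ✓p658293 turns it into `Σ_{Q_R}|∇G̃| ≲ R`.

References: G. F. Lawler, V. Limic, *Random Walk: A Modern Introduction*, CUP 2010, Thm 4.3.1, §6.3 [LawlerLimic2010]; G. F. Lawler, *Intersections of Random Walks* (1991) Thm 1.5.5;
T. Bałaban, CMP 99 (1985) 75–102 [Balaban1985RegularSpaces] ((1.36) p.82).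
-/

set_option autoImplicit false

noncomputable section

open MeasureTheory Set Finset ZMod intervalIntegral
open scoped Real BigOperators ComplexConjugate

namespace Summit.QuantumFields.YangMills.Theorems.Prop7TorusGreenGradientDecay

open Literature.Probability.LatticeModels
open Prop7TorusGreenGradientBricks

variable {d L : ℕ} [NeZero L]

/-! ## §1 The gradient: heat-kernel part plus Fourier tail -/

/-- **The gradient of the torus Green function, heat-kernel part plus Fourier tail**: for every `S`,
`G̃(z+eᵢ) − G̃(z) = ∫₀^S (∏_μ q^L_s((z+eᵢ)_μ) − ∏_μ q^L_s(z_μ)) ds + L^{-d} ∑_{k ≠ 0} (e^{-Sε_k}/ε_k) Re[χ_k(z)(χ_k(eᵢ) − 1)]`. [folklore] -/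
theorem torusGreen_grad_eq (z : TorusSite d L) (i : Fin d) (S : ℝ) :
    torusGreen (z + Pi.single i 1) - torusGreen z =
      (∫ s in (0 : ℝ)..S, ((∏ μ, torusHeatKernel s ((z + Pi.single i 1 : TorusSite d L) μ)) - ∏ μ, torusHeatKernel s (z μ))) +
      (∑ k ∈ (univ : Finset (TorusSite d L)).erase 0,
        Real.exp (-(S * dispersion (latticeMomentum L k))) / dispersion (latticeMomentum L k) *
          (torusChar k z * (torusChar k (Pi.single i 1) - 1)).re) / (L : ℝ) ^ d := by
  have hI : ∀ y : TorusSite d L, IntervalIntegrable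
      (fun s : ℝ => ∏ μ, torusHeatKernel s (y μ) - ((L : ℝ) ^ d)⁻¹) volume 0 S := fun y =>
    ((continuous_prod_torusHeatKernel y).sub continuous_const).intervalIntegrable _ _
  rw [torusGreen_eq_integral_add_tail (z + Pi.single i 1) S, torusGreen_eq_integral_add_tail z S]
  have hint : (∫ s in (0 : ℝ)..S, ((∏ μ, torusHeatKernel s ((z + Pi.single i 1 : TorusSite d L) μ)) - ∏ μ, torusHeatKernel s (z μ))) =
      (∫ s in (0 : ℝ)..S, (∏ μ, torusHeatKernel s ((z + Pi.single i 1 : TorusSite d L) μ) - ((L : ℝ) ^ d)⁻¹)) -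
      (∫ s in (0 : ℝ)..S, (∏ μ, torusHeatKernel s (z μ) - ((L : ℝ) ^ d)⁻¹)) := by
    rw [← intervalIntegral.integral_sub (hI _) (hI _)]
    congr 1
    funext s
    ring
  rw [hint]
  have htail : ∀ k : TorusSite d L,
      Real.cos (∑ μ, latticeMomentum L k μ * (((z + Pi.single i 1 : TorusSite d L) μ).val : ℝ)) *
          (Real.exp (-(S * dispersion (latticeMomentum L k))) / dispersion (latticeMomentum L k)) -
        Real.cos (∑ μ, latticeMomentum L k μ * ((z μ).val : ℝ)) *
          (Real.exp (-(S * dispersion (latticeMomentum L k))) / dispersion (latticeMomentum L k)) =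
      Real.exp (-(S * dispersion (latticeMomentum L k))) / dispersion (latticeMomentum L k) *
        (torusChar k z * (torusChar k (Pi.single i 1) - 1)).re := by
    intro k
    rw [← torusChar_re, ← torusChar_re, torusChar_add_right]
    simp only [Complex.sub_re, Complex.mul_re, Complex.one_re, Complex.one_im, Complex.sub_im]
    ring
  rw [← Finset.sum_congr rfl fun k _ => htail k, Finset.sum_sub_distrib]
  ring

/-! ## §2 The Fourier tail at `S = L²` -/

/-- **One character factor against the dispersion**: for `k ≠ 0`, `‖χ_k(eᵢ) − 1‖ ≤ (πL∕4)·ε(p_k)` (`‖χ_k(eᵢ) − 1‖ ≤ ‖p̃_k‖_∞`, `ε ≥ (2∕π²)‖p̃_k‖²_∞` on the Brillouin zone,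
and `‖p̃_k‖_∞ ≥ 2π∕L` for `k ≠ 0`). [folklore] -/
theorem norm_single_sub_one_le_dispersion (k : TorusSite d L) (hk : k ≠ 0) (i : Fin d) :
    ‖torusChar k (Pi.single i 1) - 1‖ ≤ π * L / 4 * dispersion (latticeMomentum L k) := by
  have hL : (0 : ℝ) < L := by exact_mod_cast Nat.pos_of_ne_zero (NeZero.ne L)
  set p : Fin d → ℝ := fun μ => 2 * π * ((k μ).valMinAbs : ℝ) / L with hp
  have hi : ‖torusChar k (Pi.single i 1) - 1‖ ≤ ‖p‖ := by
    rw [torusChar_single_eq_stdAddChar]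
    exact (norm_stdAddChar_sub_one_le (k i)).trans (le_of_eq_of_le (Real.norm_eq_abs _).symm (norm_le_pi_norm p i))
  have hε := mul_norm_sq_le_dispersion (centredMomentum_mem_brillouin k)
  rw [← dispersion_latticeMomentum_eq_centred] at hε
  -- `‖p‖ ≥ 2π/L` for `k ≠ 0`
  obtain ⟨μ₁, hμ₁⟩ : ∃ μ, k μ ≠ 0 := by
    by_contra h
    push Not at h
    exact hk (funext h)
  have h1 : (1 : ℝ) ≤ |((k μ₁).valMinAbs : ℝ)| := by
    have h0 : (k μ₁).valMinAbs ≠ 0 := fun h => hμ₁ ((ZMod.valMinAbs_eq_zero _).1 h)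
    rw [← Int.cast_abs]; exact_mod_cast Int.one_le_abs h0
  have hpμ : 2 * π / L ≤ ‖p‖ := by
    have hle : |p μ₁| ≤ ‖p‖ := le_of_eq_of_le (Real.norm_eq_abs _).symm (norm_le_pi_norm p μ₁)
    have e : |p μ₁| = 2 * π * |((k μ₁).valMinAbs : ℝ)| / L := by
      rw [hp]; simp only
      rw [abs_div, abs_mul, abs_mul, abs_two, abs_of_pos Real.pi_pos, Nat.abs_cast]
    rw [e] at hle
    have : 2 * π / L ≤ 2 * π * |((k μ₁).valMinAbs : ℝ)| / L := by
      rw [div_le_div_iff_of_pos_right hL]; nlinarith [Real.pi_pos]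
    exact this.trans hle
  have hp0 : 0 < ‖p‖ := lt_of_lt_of_le (by positivity) hpμ
  -- `‖p‖ ≤ ‖p‖²·(L/(2π))` and `‖p‖² ≤ (π²/2)ε`
  calc ‖torusChar k (Pi.single i 1) - 1‖ ≤ ‖p‖ := hi
    _ = ‖p‖ ^ 2 / ‖p‖ := by field_simp
    _ ≤ ‖p‖ ^ 2 / (2 * π / L) := div_le_div_of_nonneg_left (sq_nonneg _) (by positivity) hpμ
    _ = π * L / 4 * (2 / π ^ 2 * ‖p‖ ^ 2) := by field_simp; ring
    _ ≤ π * L / 4 * dispersion (latticeMomentum L k) := mul_le_mul_of_nonneg_left hε (by positivity)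

/-- ★ **The Fourier tail of the gradient is `O(L^{1−d})`**: with `C₀ = Σ_{n∈ℤ} 2^{−|n|}`, for all `z, i`,
`|L^{-d} ∑_{k≠0} (e^{-L²ε_k}/ε_k) Re[χ_k(z)(χ_k(eᵢ) − 1)]| ≤ (π∕4)·C₀^d·L∕L^d`. [folklore] -/
theorem abs_torusGreen_grad_tail_le (z : TorusSite d L) (i : Fin d) :
    |(∑ k ∈ (univ : Finset (TorusSite d L)).erase 0,
        Real.exp (-((L : ℝ) ^ 2 * dispersion (latticeMomentum L k))) / dispersion (latticeMomentum L k) *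
          (torusChar k z * (torusChar k (Pi.single i 1) - 1)).re) / (L : ℝ) ^ d| ≤
      π / 4 * (∑' n : ℤ, (1 / 2 : ℝ) ^ n.natAbs) ^ d * L / (L : ℝ) ^ d := by
  classical
  have hL : (0 : ℝ) < L := by exact_mod_cast Nat.pos_of_ne_zero (NeZero.ne L)
  have hLd : (0 : ℝ) < (L : ℝ) ^ d := by positivity
  rw [abs_div, abs_of_pos hLd, div_le_div_iff_of_pos_right hLd]
  have hterm : ∀ k ∈ (univ : Finset (TorusSite d L)).erase 0,
      |Real.exp (-((L : ℝ) ^ 2 * dispersion (latticeMomentum L k))) / dispersion (latticeMomentum L k) *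
          (torusChar k z * (torusChar k (Pi.single i 1) - 1)).re| ≤
        π * L / 4 * ∏ μ, (1 / 2 : ℝ) ^ (k μ).valMinAbs.natAbs := by
    intro k hk
    have hk0 : k ≠ 0 := Finset.ne_of_mem_erase hk
    have hε := dispersion_latticeMomentum_pos hk0
    rw [abs_mul, abs_div, Real.abs_exp, abs_of_pos hε]
    have hre : |(torusChar k z * (torusChar k (Pi.single i 1) - 1)).re| ≤ π * L / 4 * dispersion (latticeMomentum L k) := by
      refine (Complex.abs_re_le_norm _).trans ?_
      rw [norm_mul, norm_torusChar, one_mul]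
      exact norm_single_sub_one_le_dispersion k hk0 i
    have hexp : Real.exp (-((L : ℝ) ^ 2 * dispersion (latticeMomentum L k))) ≤ ∏ μ, (1 / 2 : ℝ) ^ (k μ).valMinAbs.natAbs :=
      (exp_neg_sq_mul_dispersion_le k).trans (Finset.prod_le_prod (fun μ _ => (Real.exp_pos _).le) fun μ _ => exp_neg_eight_mul_sq_le _)
    calc Real.exp (-((L : ℝ) ^ 2 * dispersion (latticeMomentum L k))) / dispersion (latticeMomentum L k) *
          |(torusChar k z * (torusChar k (Pi.single i 1) - 1)).re|
        ≤ Real.exp (-((L : ℝ) ^ 2 * dispersion (latticeMomentum L k))) / dispersion (latticeMomentum L k) *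
            (π * L / 4 * dispersion (latticeMomentum L k)) := by gcongr
      _ = π * L / 4 * Real.exp (-((L : ℝ) ^ 2 * dispersion (latticeMomentum L k))) := by field_simp
      _ ≤ π * L / 4 * ∏ μ, (1 / 2 : ℝ) ^ (k μ).valMinAbs.natAbs := by gcongr
  calc |∑ k ∈ (univ : Finset (TorusSite d L)).erase 0,
        Real.exp (-((L : ℝ) ^ 2 * dispersion (latticeMomentum L k))) / dispersion (latticeMomentum L k) *
          (torusChar k z * (torusChar k (Pi.single i 1) - 1)).re|
      ≤ ∑ k ∈ (univ : Finset (TorusSite d L)).erase 0, π * L / 4 * ∏ μ, (1 / 2 : ℝ) ^ (k μ).valMinAbs.natAbs :=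
        (Finset.abs_sum_le_sum_abs _ _).trans (Finset.sum_le_sum hterm)
    _ ≤ ∑ k : TorusSite d L, π * L / 4 * ∏ μ, (1 / 2 : ℝ) ^ (k μ).valMinAbs.natAbs :=
        Finset.sum_le_sum_of_subset_of_nonneg (Finset.erase_subset _ _) fun _ _ _ => by positivity
    _ = π * L / 4 * (∑ κ : ZMod L, (1 / 2 : ℝ) ^ κ.valMinAbs.natAbs) ^ d := by
        rw [← Finset.mul_sum]
        congr 1
        rw [show (∑ κ : ZMod L, (1 / 2 : ℝ) ^ κ.valMinAbs.natAbs) ^ d = ∏ _μ : Fin d, ∑ κ : ZMod L, (1 / 2 : ℝ) ^ κ.valMinAbs.natAbs by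
          rw [Finset.prod_const, Finset.card_univ, Fintype.card_fin], Finset.prod_univ_sum]
        simp only [Fintype.piFinset_univ]
    _ ≤ π * L / 4 * (∑' n : ℤ, (1 / 2 : ℝ) ^ n.natAbs) ^ d := by
        gcongr
        exact sum_half_pow_valMinAbs_le
    _ = π / 4 * (∑' n : ℤ, (1 / 2 : ℝ) ^ n.natAbs) ^ d * L := by ring

/-! ## §3 ★★★ The gradient decay in `d = 3` -/

/-- ★★★ **DECAY OF THE GRADIENT OF THE TORUS GREEN FUNCTION IN `d = 3`, UNIFORMLY IN THE PERIOD.**  There is an absolute constant `C` such that for every `L ≥ 1`, every direction `i`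
and every `z ≠ 0` in `(ℤ/Lℤ)³`:  `|G̃_L(z+eᵢ) − G̃_L(z)|·(Σ_μ z̃_μ²) ≤ C`  (`G̃_L = torusGreen`, `z̃_μ = valMinAbs (z μ)`; `Σ_μ z̃_μ² = dist(0,z)²`): the lattice, finite-volume form of
`|∇|x|⁻¹| ≲ |x|⁻²` (cf. Lawler–Limic 2010 Thm 4.3.1∕§6.3 on `ℤ³`).  Heat-kernel part `≤ K·∫₀^{L²}((s+M²)²)⁻¹ds ≤ K∕M²` (✓ `abs_grad_prod_torusHeatKernel_le`, ✓ `integral_inv_add_sq_le`,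
`M = max_μ|z̃_μ| ≥ 1`), Fourier tail `≤ (π∕4)C₀³L⁻² ≤ (π∕16)C₀³M⁻²` (`2M ≤ L`), and `Σ_μz̃_μ² ≤ 3M²`. [folklore] -/
theorem torusGreen_grad_mul_dist_sq_le : ∃ C : ℝ, ∀ (L : ℕ) [NeZero L] (i : Fin 3) (z : TorusSite 3 L), z ≠ 0 →
    |torusGreen (z + Pi.single i 1) - torusGreen z| * (∑ k, (((z k).valMinAbs : ℤ) : ℝ) ^ 2) ≤ C := by
  obtain ⟨K, hK, hP⟩ := abs_grad_prod_torusHeatKernel_le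
  set C₀ : ℝ := ∑' n : ℤ, (1 / 2 : ℝ) ^ n.natAbs with hC₀
  refine ⟨3 * K + 3 * (π / 16 * C₀ ^ 3), ?_⟩
  intro L _ i z hz
  have hL : (0 : ℝ) < L := by exact_mod_cast Nat.pos_of_ne_zero (NeZero.ne L)
  -- the largest centred coordinate
  obtain ⟨μ₀, -, hμ₀⟩ := Finset.exists_max_image (univ : Finset (Fin 3)) (fun μ => (z μ).valMinAbs.natAbs) Finset.univ_nonempty
  set M : ℝ := |((z μ₀).valMinAbs : ℝ)| with hM
  have hMμ : ∀ μ, |((z μ).valMinAbs : ℝ)| ≤ M := fun μ => by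
    have h := hμ₀ μ (Finset.mem_univ μ)
    rw [hM, ← Int.cast_abs, ← Int.cast_abs, ← Int.natCast_natAbs, ← Int.natCast_natAbs]
    exact_mod_cast h
  have hM1 : 1 ≤ M := by
    obtain ⟨μ₁, hμ₁⟩ : ∃ μ, z μ ≠ 0 := by
      by_contra h
      push Not at h
      exact hz (funext h)
    have h1 : (z μ₁).valMinAbs ≠ 0 := fun h => hμ₁ ((ZMod.valMinAbs_eq_zero _).1 h)
    have h2 : (1 : ℝ) ≤ |((z μ₁).valMinAbs : ℝ)| := by
      rw [← Int.cast_abs]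
      exact_mod_cast Int.one_le_abs h1
    exact h2.trans (hMμ μ₁)
  have hM0 : 0 < M := by linarith
  have hML : 2 * M ≤ L := by
    have h := two_mul_abs_valMinAbs_le (z μ₀)
    rw [hM, ← Int.cast_abs]
    exact_mod_cast h
  -- the squared distance
  have hdist : ∑ k, (((z k).valMinAbs : ℤ) : ℝ) ^ 2 ≤ 3 * M ^ 2 := by
    calc ∑ k, (((z k).valMinAbs : ℤ) : ℝ) ^ 2 ≤ ∑ _k : Fin 3, M ^ 2 :=
          Finset.sum_le_sum fun k _ => by
            rw [← sq_abs]
            exact pow_le_pow_left₀ (abs_nonneg _) (hMμ k) 2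
      _ = 3 * M ^ 2 := by simp
  have hdist0 : 0 ≤ ∑ k, (((z k).valMinAbs : ℤ) : ℝ) ^ 2 := Finset.sum_nonneg fun k _ => sq_nonneg _
  -- heat-kernel part and tail at `S = L²`
  have hS : (0 : ℝ) ≤ (L : ℝ) ^ 2 := by positivity
  rw [torusGreen_grad_eq z i ((L : ℝ) ^ 2)]
  have hmain : |∫ s in (0 : ℝ)..(L : ℝ) ^ 2,
      ((∏ μ, torusHeatKernel s ((z + Pi.single i 1 : TorusSite 3 L) μ)) - ∏ μ, torusHeatKernel s (z μ))| ≤ K * (M ^ 2)⁻¹ := by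
    have hb : ∀ s ∈ Set.Ioc (0 : ℝ) ((L : ℝ) ^ 2),
        |(∏ μ, torusHeatKernel s ((z + Pi.single i 1 : TorusSite 3 L) μ)) - ∏ μ, torusHeatKernel s (z μ)| ≤ K * ((s + M ^ 2) ^ 2)⁻¹ := by
      intro s hs
      refine (hP L s hs.1 hs.2 z i μ₀).trans ?_
      rw [hM, sq_abs]
      set T : ℝ := max 1 s with hT
      set c : ℝ := ((z μ₀).valMinAbs : ℝ) ^ 2 with hc
      have hc0 : 0 ≤ c := sq_nonneg _
      have hTs : s ≤ T := le_max_right _ _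
      have hT0 : 0 < T := lt_of_lt_of_le hs.1 hTs
      have hTc : 0 < T + c := by linarith
      have hsc : 0 < s + c := by linarith [hs.1]
      -- `T·((T+c)³)⁻¹ ≤ ((T+c)²)⁻¹ ≤ ((s+c)²)⁻¹`
      have h1 : T * ((T + c) ^ 3)⁻¹ ≤ ((T + c) ^ 2)⁻¹ := by
        have hTc' : (T + c) ≠ 0 := hTc.ne'
        have e : T * ((T + c) ^ 3)⁻¹ = (T / (T + c)) * ((T + c) ^ 2)⁻¹ := by
          field_simp
        rw [e]
        calc T / (T + c) * ((T + c) ^ 2)⁻¹ ≤ 1 * ((T + c) ^ 2)⁻¹ :=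
              mul_le_mul_of_nonneg_right (div_le_one_of_le₀ (by linarith) hTc.le) (by positivity)
          _ = ((T + c) ^ 2)⁻¹ := one_mul _
      have h2 : ((T + c) ^ 2)⁻¹ ≤ ((s + c) ^ 2)⁻¹ := by
        apply inv_anti₀ (by positivity)
        exact pow_le_pow_left₀ hsc.le (by linarith) 2
      calc K * T * ((T + c) ^ 3)⁻¹ = K * (T * ((T + c) ^ 3)⁻¹) := by ring
        _ ≤ K * ((s + c) ^ 2)⁻¹ := mul_le_mul_of_nonneg_left (h1.trans h2) hK.le
    have hcont : IntervalIntegrable (fun s : ℝ => K * ((s + M ^ 2) ^ 2)⁻¹) volume 0 ((L : ℝ) ^ 2) := by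
      refine ContinuousOn.intervalIntegrable ?_
      rw [Set.uIcc_of_le hS]
      refine continuousOn_const.mul (ContinuousOn.inv₀ ((continuousOn_id.add continuousOn_const).pow 2) fun s hs => ?_)
      have : 0 < s + M ^ 2 := by have := hs.1; positivity
      positivity
    calc _ ≤ ∫ s in (0 : ℝ)..(L : ℝ) ^ 2, K * ((s + M ^ 2) ^ 2)⁻¹ := by
          have h := intervalIntegral.norm_integral_le_of_norm_le hS
            (Filter.Eventually.of_forall fun s hs => (Real.norm_eq_abs _).le.trans (hb s hs)) hcont
          rwa [Real.norm_eq_abs] at h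
      _ = K * ∫ s in (0 : ℝ)..(L : ℝ) ^ 2, ((s + M ^ 2) ^ 2)⁻¹ := intervalIntegral.integral_const_mul _ _
      _ ≤ K * (M ^ 2)⁻¹ := by
          gcongr
          exact integral_inv_add_sq_le (by positivity) hS
  have htail := abs_torusGreen_grad_tail_le z i
  rw [← hC₀] at htail
  -- `L/L³ = 1/L² ≤ 1/(4M²)`
  have hL3 : (L : ℝ) / (L : ℝ) ^ 3 ≤ (4 * M ^ 2)⁻¹ := by
    rw [show (L : ℝ) / (L : ℝ) ^ 3 = ((L : ℝ) ^ 2)⁻¹ by field_simp]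
    apply inv_anti₀ (by positivity)
    nlinarith
  calc _ ≤ (K * (M ^ 2)⁻¹ + π / 4 * C₀ ^ 3 * L / (L : ℝ) ^ 3) * (3 * M ^ 2) :=
        mul_le_mul ((abs_add_le _ _).trans (add_le_add hmain htail)) hdist hdist0 (by positivity)
    _ ≤ (K * (M ^ 2)⁻¹ + π / 4 * C₀ ^ 3 * (4 * M ^ 2)⁻¹) * (3 * M ^ 2) := by
        gcongr
        rw [mul_div_assoc]
        gcongr
    _ = 3 * K + 3 * (π / 16 * C₀ ^ 3) := by
        field_simp
        ring

end Summit.QuantumFields.YangMills.Theorems.Prop7TorusGreenGradientDecay
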